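import Summits.BirchSwinnertonDyer.BirchSwinnertonDyer.Theorems.CMKolyvaginAtInertTwoShaCountCompositeTwistAtTwo
import Summits.BirchSwinnertonDyer.BirchSwinnertonDyer.Theorems.CMKolyvaginAtInertTwoShaCountGeneralAtTwo
import HarnessLib

/-!
# Route `CMKolyvaginAtInertTwo`, crux `CMKolyvaginExactAtInertTwo` (stmt-BirchSwinnertonDyer-24277):
# THE COUNT IDENTITY, XV — EVERY ODD `d_K` (composite allowed), both signs of `Δ`:
# `ord₂ #Ш(E_K) + 1 = [Δ > 0] + ord₂ #Ш(E) + ord₂ #Ш(E^{(d_K)}) + Σ_{q ∣ d_K} ([(Δ/q) = −1] + 2·[(Δ/q) = 1 ∧ a_q even])`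

Seat `bsd-line-cmk2-p1` g15 (cell `bsd-print-cf2`); helper (`--supports stmt-BirchSwinnertonDyer-24277`).
THEOREMS ONLY: no definition, no named fact, no `sorry`; the route's published inputs (Gross–Zagier
all levels, GZK, modularity, Milne any-model) are HYPOTHESES of the capstone; no item is closed; BSD
is not proved by this.

Files IX/XI gave the bridge `#Ш(E_K)[2^∞] ↔ #Ш(E)[2^∞]·#Ш(E^{(d_K)})[2^∞]` on PRIME Heegner fields.
The sibling cruxes of route `GenusKolyvaginAtTwo` (habitats R: `Δ < 0`, T: `Δ > 0`) assume only
`d_K` odd. With file XIV (twist model and `2`-adic Tamagawa product for composite `d_K`) the same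
`2`-adic bookkeeping of Milne's quotient (`natIdentity_of_milne_general`: regulator EXACT by the
averaging trick, torsion exact, `∏c(E_K) = (∏c(E))²`) gives, for EVERY odd fundamental `d_K`
satisfying the Heegner hypothesis:

* `padicValNat_two_shaOrder_baseChange_eq_of_milne_composite` — **`ord₂ #Ш(E_K) + 1 =
  [Δ > 0] + ord₂ #Ш(E) + ord₂ #Ш(Wd) + Σ_{q ∣ d_K} ([(Δ/q) = −1] + 2·[(Δ/q) = 1 ∧ a_q(E) even])`**
  (modulo Milne; `Wd` a globally minimal model of the twist with `|u| = 1`, total rank one,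
  `E(K)[2] = 0`, finiteness of `Ш(E)`, `Ш(Wd)` as hypotheses);
* `card_primaryComponent_sha_two_baseChange_mul_two_eq_of_heegnerData_of_facts` — **THE CAPSTONE for
  every odd `d_K`**: for `W` globally minimal with `ρ̄_{E,2}` onto, `K` imaginary quadratic with
  `d_K` odd and the Heegner hypothesis, and a Heegner datum with `y_K = P(1)` of infinite order,
  `Ш(E_K)` is finite and `#Ш(E_K)[2^∞] · 2 = n_E · #Ш(E)[2^∞] · #Ш(E^{(d_K)})[2^∞] · 2^{Σ_q(…)}`
  with `n_E = 2` if `Δ > 0`, `1` if `Δ < 0` (modulo GZ, GZK, modularity, Milne).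

On a prime Heegner field `Σ_q(…) = [(Δ/q) = −1] + 2[(Δ/q) = 1 ∧ a_q even]` with `(Δ/q) = sign Δ`
(file X), recovering XI. For composite `d_K = −q₁⋯q_g` only the PRODUCT `∏ (Δ/q_i) = sign Δ` is
forced, so the individual local factors `c_{q_i}(E^{(d_K)}) ∈ {1, 2, 4}` genuinely enter: the pair
count `#Ш(E)[2^∞]·#Ш(E^{(d_K)})[2^∞]` is `2^{2M₀}` only up to this explicit, computable power of `2`
(KERNEL-STATUS §14.1) — the reason the TURNKEY restates 24277 on prime `|d_K|`.
References: Milne 1972 §1; Kramer 1981 Prop. 3; Gross–Zagier 1986 V.§2; Gross 1991 §§1–2.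
-/

-- single-conjunct summit: `Summit.BirchSwinnertonDyer.BirchSwinnertonDyer.…` repeats the name by design
set_option linter.dupNamespace false
set_option autoImplicit false

noncomputable section

open scoped Classical

open WeierstrassCurve NumberField Literature.NumberTheory.EllipticCurves
  Literature.NumberTheory.EllipticCurves.ModularForms Literature.NumberTheory.QuadraticFields
  Summit.BirchSwinnertonDyer.Rank1Residual.AdditivePotMult

namespace Summit.BirchSwinnertonDyer.BirchSwinnertonDyer.Theorems.ShaCountTwo

section Composite

variable (W : WeierstrassCurve ℚ) [W.IsElliptic] [W.IsGloballyMinimal]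
  (K : Type) [Field K] [NumberField K] (hK : IsImaginaryQuadratic K)
  (hodd : Odd (NumberField.discr K)) (hH : SatisfiesHeegnerHypothesis (W.conductorNorm ℤ) K)
  (Wd : WeierstrassCurve ℚ) [Wd.IsElliptic] [Wd.IsGloballyMinimal] (Cd : VariableChange ℚ)
  (hWd : Cd • W.quadraticTwist (NumberField.discr K : ℚ) = Wd) (hu : |(Cd.u : ℚ)| = 1)
  (hr : W.mordellWeilRank + Wd.mordellWeilRank = 1)
  (h2t : ∀ P : (W.baseChange K).toAffine.Point, (2 : ℕ) • P = 0 → P = 0)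

include hK hodd hH hWd hu hr h2t in
/-- **`ord₂ #Ш(E_K) + 1 = [Δ > 0] + ord₂ #Ш(E) + ord₂ #Ш(E_d) + Σ_{q ∣ d_K} ([(Δ/q) = −1] +
2·[(Δ/q) = 1 ∧ a_q(E) even])`** for EVERY odd `d_K` (modulo Milne): `ord₂ n_E = [Δ > 0]`,
`∏c(E_K) = (∏c(E))²` (IIIa), `#E(K)_t = #E_t·#E_{d,t}` (II), `Reg(E_K) = 2·Reg(E)·Reg(E_d)` (I),
and the twist's Tamagawa product by file XIV. `Δ = W.Δ.num` is the minimal discriminant; the sum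
is over the prime factors of `|d_K|`. [cite: Kramer1981, Prop. 3] [cite: Milne1972ArithmeticAV, §1 Thm. 1] -/
theorem padicValNat_two_shaOrder_baseChange_eq_of_milne_composite
    (hMilneC : Milne1972.bsdQuotient_baseChange_quadratic_anyModel) [Finite W.sha] [Finite Wd.sha] :
    Finite (W.baseChange K).sha ∧
      padicValNat 2 (W.baseChange K).shaOrder + 1 =
        (if 0 < W.Δ then 1 else 0) + padicValNat 2 W.shaOrder + padicValNat 2 Wd.shaOrder +
          ∑ q ∈ (NumberField.discr K).natAbs.primeFactors,
            ((if jacobiSym W.Δ.num q = -1 then 1 else 0) +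
              (if jacobiSym W.Δ.num q = 1 ∧ Even (W.frobeniusTrace q) then 2 else 0)) := by
  haveI : Fact (Nat.Prime 2) := ⟨Nat.prime_two⟩
  have h2 : Module.finrank ℚ K = 2 := hK.1
  haveI hEK : (W.baseChange K).IsElliptic := by rw [baseChange]; infer_instance
  obtain ⟨hshaK, hid⟩ := natIdentity_of_milne_general W K hK hH Wd Cd hWd hu hr h2t hMilneC
  haveI : Finite (W.baseChange K).sha := hshaK
  refine ⟨hshaK, ?_⟩
  set J : ℕ := ∑ q ∈ (NumberField.discr K).natAbs.primeFactors,
    ((if jacobiSym W.Δ.num q = -1 then 1 else 0) +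
      (if jacobiSym W.Δ.num q = 1 ∧ Even (W.frobeniusTrace q) then 2 else 0)) with hJ
  set a : ℕ := (if 0 < W.Δ then 1 else 0) with ha
  have hV : ∃ C : VariableChange K, C • W.baseChange K = W.baseChange K := ⟨1, one_smul _ _⟩
  have hTK : (W.baseChange K).tamagawaProduct = W.tamagawaProduct ^ 2 :=
    tamagawaProduct_baseChange_eq_sq_of_heegner W K h2 hH
  have hTd : padicValNat 2 Wd.tamagawaProduct = padicValNat 2 W.tamagawaProduct + J :=
    padicValNat_two_tamagawaProduct_twist_of_heegner W K hK hodd hH Cd hWd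
  have htor : (W.baseChange K).torsionOrder = W.torsionOrder * Wd.torsionOrder :=
    torsionOrder_baseChange_quadratic_eq_mul_of_forall_two_nsmul W K h2 Wd ⟨Cd, hWd⟩ (W.baseChange K)
      hV h2t
  have hnR : (W.baseChange ℝ).numRealComponents = if 0 < W.Δ then 2 else 1 :=
    numRealComponents_baseChange_real W
  -- the archimedean factor
  obtain ⟨nR, hnRv, hnRa⟩ : ∃ nR : ℕ, (W.baseChange ℝ).numRealComponents = nR ∧
      padicValNat 2 nR = a := by
    by_cases hpos : 0 < W.Δ
    · exact ⟨2, by rw [hnR, if_pos hpos], by rw [padicValNat_self, ha, if_pos hpos]⟩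
    · exact ⟨1, by rw [hnR, if_neg hpos], by rw [padicValNat_one_right, ha, if_neg hpos]⟩
  have hnR0 : nR ≠ 0 := by rw [← hnRv]; exact (W.baseChange ℝ).numRealComponents_pos.ne'
  -- non-vanishing
  have hS0 : W.shaOrder ≠ 0 := (W.shaOrder_pos ‹Finite W.sha›).ne'
  have hSd0 : Wd.shaOrder ≠ 0 := (Wd.shaOrder_pos ‹Finite Wd.sha›).ne'
  have hSK0 : (W.baseChange K).shaOrder ≠ 0 := ((W.baseChange K).shaOrder_pos hshaK).ne'
  have hT0 : W.tamagawaProduct ≠ 0 := W.tamagawaProduct_pos'.ne'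
  have hTd0 : Wd.tamagawaProduct ≠ 0 := Wd.tamagawaProduct_pos'.ne'
  have ht0 : W.torsionOrder ≠ 0 := W.torsionOrder_pos_holds.ne'
  have htd0 : Wd.torsionOrder ≠ 0 := Wd.torsionOrder_pos_holds.ne'
  rw [hTK, htor, hnRv] at hid
  have hv := congrArg (padicValNat 2) hid
  rw [padicValNat.mul (mul_ne_zero (mul_ne_zero (mul_ne_zero (mul_ne_zero hnR0 hS0) hSd0) hT0) hTd0)
        (pow_ne_zero 2 (mul_ne_zero ht0 htd0)),
    padicValNat.mul (mul_ne_zero (mul_ne_zero (mul_ne_zero hnR0 hS0) hSd0) hT0) hTd0,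
    padicValNat.mul (mul_ne_zero (mul_ne_zero hnR0 hS0) hSd0) hT0,
    padicValNat.mul (mul_ne_zero hnR0 hS0) hSd0, padicValNat.mul hnR0 hS0,
    padicValNat.mul (mul_ne_zero (mul_ne_zero (mul_ne_zero hSK0 (pow_ne_zero 2 hT0))
        (pow_ne_zero 2 ht0)) (pow_ne_zero 2 htd0)) two_ne_zero,
    padicValNat.mul (mul_ne_zero (mul_ne_zero hSK0 (pow_ne_zero 2 hT0)) (pow_ne_zero 2 ht0))
      (pow_ne_zero 2 htd0),
    padicValNat.mul (mul_ne_zero hSK0 (pow_ne_zero 2 hT0)) (pow_ne_zero 2 ht0),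
    padicValNat.mul hSK0 (pow_ne_zero 2 hT0), padicValNat.pow, padicValNat.pow, padicValNat.pow,
    padicValNat.pow, padicValNat.mul ht0 htd0, hTd, hnRa, padicValNat_self] at hv
  omega

end Composite

/-! ## The capstone for every odd `d_K` -/

/-- **THE COUNT IDENTITY FOR EVERY ODD `d_K` (composite allowed), both signs of `Δ`, modulo the
published inputs** (Gross–Zagier all levels, GZK, modularity, Milne any-model). `W/ℚ` globally
minimal with `ρ̄_{E,2}` onto; `K` imaginary quadratic with `d_K` odd satisfying the Heegner
hypothesis for `N(W)`; `Dt` a parametrisation datum, `d₁` Kolyvagin–Heegner data of conductor `1`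
with `P(1)` of infinite order. THEN `Ш(E_K)` is finite and
**`#Ш(E_K)[2^∞] · 2 = n_E · #Ш(E)[2^∞] · #Ш(E^{(d_K)})[2^∞] · 2^{Σ_{q ∣ d_K} ([(Δ/q) = −1] + 2·[(Δ/q) = 1 ∧ a_q even])}`**,
`n_E = 2` if `Δ > 0` and `1` if `Δ < 0` (`Δ = W.Δ.num` the minimal discriminant, the sum over the
prime factors of `|d_K|`). The twist model (XIV), total rank one and finiteness (VIII) and
`E(K)[2] = 0` (`ρ̄_{E,2}` onto, `[K:ℚ]` prime to `3`) are discharged; `Ш` is model-independent.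
[cite: Milne1972ArithmeticAV, §1 Thm. 1 and §2 (through DokchitserDokchitserAnnals2010, §2.1, proof of Thm. 2.3)]
[cite: GrossZagier1986, Thm. I.(6.3) with V.§2] [cite: Kramer1981, Prop. 3] -/
theorem card_primaryComponent_sha_two_baseChange_mul_two_eq_of_heegnerData_of_facts
    (hGZ : ∀ (N : ℕ) [NeZero N] (W : WeierstrassCurve ℚ) (K : Type) [Field K] [NumberField K],
      gross_zagier N W K)
    (hGZK : rank_eq_analyticRank_of_analyticRank_le_one) (hmod : hasEntireLFunction_rat)
    (hMilneC : Milne1972.bsdQuotient_baseChange_quadratic_anyModel)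
    (W : WeierstrassCurve ℚ) [W.IsElliptic] [W.IsGloballyMinimal] [NeZero (W.conductorNorm ℤ)]
    (hsurj : W.HasSurjectiveModNGaloisRep 2)
    (K : Type) [Field K] [NumberField K] (hK : IsImaginaryQuadratic K)
    (hodd : Odd (NumberField.discr K)) (hH : SatisfiesHeegnerHypothesis (W.conductorNorm ℤ) K)
    (Dt : ModularParametrizationData W (W.conductorNorm ℤ)) (β : ℤ) (ι : K →+* ℂ)
    (d₁ : KolyvaginHeegnerData Dt β ι 1) (hy : ¬ IsOfFinAddOrder d₁.derivedPoint) :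
    Finite (W.baseChange K).sha ∧
      Nat.card (AddCommGroup.primaryComponent (W.baseChange K).sha 2) * 2 =
        (if 0 < W.Δ then 2 else 1) *
          (Nat.card (AddCommGroup.primaryComponent W.sha 2) *
            Nat.card (AddCommGroup.primaryComponent
              (W.quadraticTwist (NumberField.discr K : ℚ)).sha 2)) *
          2 ^ ∑ q ∈ (NumberField.discr K).natAbs.primeFactors,
            ((if jacobiSym W.Δ.num q = -1 then 1 else 0) +
              (if jacobiSym W.Δ.num q = 1 ∧ Even (W.frobeniusTrace q) then 2 else 0)) := by
  haveI : Fact (Nat.Prime 2) := ⟨Nat.prime_two⟩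
  obtain ⟨Wd, Cd, hWd, hu, hEd, hmin⟩ := exists_isGloballyMinimal_twist_of_heegner W K hK hodd hH
  haveI : Wd.IsElliptic := hEd
  haveI : Wd.IsGloballyMinimal := hmin
  obtain ⟨hr, hfinW, hfinD⟩ := rank_add_eq_one_and_finite_sha_of_heegnerData_of_facts hGZ hGZK hmod W K
    hK hH Dt β ι d₁ hy Wd ⟨Cd, hWd⟩
  haveI : Finite W.sha := hfinW
  haveI : Finite Wd.sha := hfinD
  have h2t : ∀ P : (W.baseChange K).toAffine.Point, (2 : ℕ) • P = 0 → P = 0 :=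
    forall_two_nsmul_baseChange_of_hasSurjectiveModNGaloisRep_two_of_isImaginaryQuadratic W hsurj K hK
  obtain ⟨hshaK, hv⟩ := padicValNat_two_shaOrder_baseChange_eq_of_milne_composite W K hK hodd hH Wd Cd
    hWd hu hr h2t hMilneC
  haveI : Finite (W.baseChange K).sha := hshaK
  refine ⟨hshaK, ?_⟩
  set J : ℕ := ∑ q ∈ (NumberField.discr K).natAbs.primeFactors,
    ((if jacobiSym W.Δ.num q = -1 then 1 else 0) +
      (if jacobiSym W.Δ.num q = 1 ∧ Even (W.frobeniusTrace q) then 2 else 0)) with hJ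
  set a : ℕ := (if 0 < W.Δ then 1 else 0) with ha
  have h2c : (if 0 < W.Δ then 2 else 1 : ℕ) = 2 ^ a := by
    rw [ha]; split_ifs <;> rfl
  have hv' : padicValNat 2 (Nat.card (W.baseChange K).sha) + 1 =
      a + padicValNat 2 (Nat.card W.sha) + padicValNat 2 (Nat.card Wd.sha) + J := hv
  rw [← card_primaryComponent_sha_variableChange (W.quadraticTwist (NumberField.discr K : ℚ)) Cd, hWd,
    natCard_primaryComponent_eq_pow_padicValNat 2, natCard_primaryComponent_eq_pow_padicValNat 2,
    natCard_primaryComponent_eq_pow_padicValNat 2, h2c, ← pow_succ, ← pow_add, ← pow_add, ← pow_add]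
  exact congrArg (2 ^ ·) (by omega)

end Summit.BirchSwinnertonDyer.BirchSwinnertonDyer.Theorems.ShaCountTwo

end
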